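import Mathlib.RingTheory.MvPolynomial.Homogeneous
import Mathlib.RingTheory.Localization.AtPrime.Basic
import Mathlib.LinearAlgebra.Matrix.Block
import Mathlib.LinearAlgebra.Matrix.Reindex
import Mathlib.FieldTheory.IsAlgClosed.Basic
import Mathlib.Algebra.MvPolynomial.Eval
import HarnessLib

/-!
# Kerner–Vinnikov: global-from-local decomposability of determinantal representations

A NAMED FACT (D-0014, statement only), in MATRIX language (matrices over `MvPolynomial`,
`Localization.AtPrime`), as requested by route ValiantsHypothesis/UlrichPadded (pair
`f₁ = x₀ᵏ`, `f₂ = perₙ`):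

* `KernerVinnikov2012_globallyDecomposable_iff` — D. Kerner, V. Vinnikov, *Determinantal
  representations of singular hypersurfaces in ℙⁿ*, Adv. Math. 231 (2012) 1619–1654
  (= arXiv:0906.3012, held text, §3), **Theorem 3.1**: "Let `X = X₁ ∪ X₂ ⊂ ℙⁿ` be a global
  decomposition of the hypersurface. Here `X₁, X₂` can be further reducible, non-reduced, but without
  common components. `ℳ` is globally decomposable, i.e. `ℳ ∼ ℳ₁ ⊕ ℳ₂` globally, iff it is locally
  decomposable at each point `pt ∈ X`, i.e. `ℳ ∼ 𝟙 ⊕ ℳ₁|_{(ℙⁿ,pt)} ⊕ ℳ₂|_{(ℙⁿ,pt)}` locally. Here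
  `ℳ_α|_{(ℙⁿ,pt)}` are the local determinantal representations near `pt ∈ ℙⁿ`, one works over
  `𝒪 = k[x₁, …, xₙ]_{(pt)}`", together with the **Proposition** after it, part 1: "Suppose at each
  point `pt ∈ X₁ ∩ X₂` the determinantal representation is locally decomposable … Then `ℳ` is globally
  decomposable" (proof: Noether's `AF + BG`; resp. the kernel sheaves and the sheaf axiom).

## Setting of the source (§1.1) and the rendering

* `k` "an algebraically closed, normed field of zero characteristic, e.g. the complex numbers" —
  here any algebraically closed field of characteristic zero (the norm plays no role in §3; any field
  carries the trivial norm). A (global) determinantal representation of the hypersurface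
  `X = {det ℳ = 0} ⊂ ℙⁿ`: a `d × d` matrix of LINEAR FORMS, `ℳ ∈ Mat(d × d, H⁰(𝒪_{ℙⁿ}(1)))`, here
  `M : Matrix (Fin d) (Fin d) (MvPolynomial (Fin (n+1)) k)` with every entry homogeneous of degree
  `1` and `det M = f₁ f₂`, `f_α` homogeneous of degree `d_α ≥ 1` (so `d = d₁ + d₂ > 1`), coprime
  (`IsRelPrime`; "reducible, non-reduced, but mutually prime" — NO reducedness is assumed).
* GLOBAL equivalence `ℳ ∼ A ℳ B`, `A, B ∈ GL(d, k)`: constant invertible matrices (`A.map C`).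
  "Globally decomposable `ℳ ∼ ℳ₁ ⊕ ℳ₂`" with `ℳ_α` determinantal representations of `X_α`:
  `A M B = M₁ ⊕ M₂` (block diagonal, `Matrix.fromBlocks … 0 0 …` reindexed along
  `Fin d₁ ⊕ Fin d₂ ≃ Fin (d₁ + d₂)`), `det M_α = c_α f_α`, `c_α ∈ kˣ` (sizes are then forced to be
  `d_α = deg f_α`; "the multiplicities are determined uniquely").
* LOCAL equivalence at a point, `A, B ∈ GL(d, 𝒪)`: the source dehomogenises and works over the
  local ring `k[x₁,…,xₙ]_{(pt)}` of the affine chart. CHART-FREE RENDERING USED HERE: for a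
  representative `a ∈ kⁿ⁺¹ ∖ {0}` of `pt` we work over the local ring
  `𝒪_a = k[x₀,…,xₙ]_{𝔪_a}`, `𝔪_a = ker (eval a)` (`Localization.AtPrime (RingHom.ker (eval a))`),
  of the affine cone at `a`, with the ORIGINAL homogeneous `M` (entries mapped by `algebraMap`). This
  is equivalent to the printed condition: `𝒪_{ℙⁿ,pt} → 𝒪_a` (degree-`0` fractions) has the
  retraction `𝒪_a ↠ 𝒪_{H,a} ≅ 𝒪_{ℙⁿ,pt}` (restrict to the affine hyperplane `H = {xᵢ = aᵢ}`
  through `a`, which maps isomorphically onto the chart `xᵢ ≠ 0`), and over `𝒪_a` the matrix `M` is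
  equivalent to its dehomogenisation `M/ℓ` (`ℓ` a linear form with `ℓ(a) ≠ 0` is a unit of `𝒪_a`);
  so a local decomposition over either ring yields one over the other.
* "`ℳ ∼ 𝟙 ⊕ ℳ₁|_pt ⊕ ℳ₂|_pt` locally": `A M B = 𝟙_r ⊕ N₁ ⊕ N₂` over `𝒪_a` with `A, B`
  invertible, `N_α` square of size `e_α` (`r + e₁ + e₂ = d`) and `det N_α = u_α · f_α`, `u_α ∈ 𝒪_aˣ`
  (a local determinantal representation of the germ `(X_α, pt)`: its determinant is the local
  equation of `X_α` up to a unit; empty blocks allowed). The condition is imposed at the points of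
  `X₁ ∩ X₂` (`f₁(a) = 0 = f₂(a)`), as in the Proposition; at the other points of `X` it holds
  trivially (`f₂(a) ≠ 0 ⇒ f₂ ∈ 𝒪_aˣ`, take `N₁ = M`, `N₂` empty), so this is also the Theorem's
  "each point `pt ∈ X`".
* NOT vendored: part 2 of the Proposition (upper block-triangular forms) and the Corollary
  (complete decomposability of `X'/X`-saturated / maximally generated representations).

## References

* [KernerVinnikov2012] D. Kerner, V. Vinnikov, Determinantal representations of singular
  hypersurfaces in ℙⁿ, Adv. Math. 231 (2012) 1619–1654; arXiv:0906.3012, §1.1 (setting), §3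
  Thm. 3.1 and the Proposition following it.
* E. Arbarello, M. Cornalba, P. Griffiths, J. Harris, Geometry of Algebraic Curves I (Noether's
  `AF + BG` theorem), as used in the printed proof.
-/

noncomputable section

open MvPolynomial Matrix

namespace Literature.AlgebraicGeometry.DeterminantalHypersurfaces

/-- The index equivalence `Fin r ⊕ (Fin e₁ ⊕ Fin e₂) ≃ Fin d` for `r + e₁ + e₂ = d`, used to place
the blocks `𝟙_r ⊕ N₁ ⊕ N₂` in a `d × d` matrix. [folklore] -/
def blockIndexEquiv {r e₁ e₂ d : ℕ} (h : r + e₁ + e₂ = d) : Fin r ⊕ (Fin e₁ ⊕ Fin e₂) ≃ Fin d :=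
  ((Equiv.refl (Fin r)).sumCongr finSumFinEquiv).trans (finSumFinEquiv.trans (finCongr (by omega)))

/-- **Kerner–Vinnikov 2012, Thm. 3.1 with the Proposition following it (global-from-local
decomposability of determinantal representations; non-reduced components allowed).** Over an
algebraically closed field `k` of characteristic zero, let `f₁, f₂ ∈ k[x₀,…,xₙ]` be coprime
homogeneous forms of degrees `d₁, d₂ ≥ 1` (each possibly reducible and non-reduced) and `M` a
`(d₁+d₂) × (d₁+d₂)` matrix of linear forms with `det M = f₁ f₂` — a determinantal representation
of `X = X₁ ∪ X₂`, `X_α = {f_α = 0} ⊂ ℙⁿ`. Then `M` is GLOBALLY decomposable — `A M B = M₁ ⊕ M₂`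
for constant invertible `A, B` with `det M_α = c_α f_α`, `c_α ≠ 0` — iff at every point of
`X₁ ∩ X₂` (every `a ∈ kⁿ⁺¹ ∖ 0` with `f₁(a) = f₂(a) = 0`) it is LOCALLY decomposable over the local
ring `𝒪_a = k[x]_{ker (eval a)}`: `A M B = 𝟙_r ⊕ N₁ ⊕ N₂` with `A, B` invertible over `𝒪_a` and
`det N_α = (unit) · f_α`. See the module docstring for the (chart-free) rendering of "one works over
`𝒪 = k[x₁,…,xₙ]_{(pt)}`". [cite: KernerVinnikov2012, §3 Thm. 3.1 and the Proposition following it (part 1)] -/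
def KernerVinnikov2012_globallyDecomposable_iff : Prop :=
  ∀ (k : Type) [Field k] [IsAlgClosed k] [CharZero k] (n d₁ d₂ : ℕ), 0 < d₁ → 0 < d₂ →
    ∀ (f₁ f₂ : MvPolynomial (Fin (n + 1)) k), f₁.IsHomogeneous d₁ → f₂.IsHomogeneous d₂ →
      IsRelPrime f₁ f₂ →
    ∀ (M : Matrix (Fin (d₁ + d₂)) (Fin (d₁ + d₂)) (MvPolynomial (Fin (n + 1)) k)),
      (∀ i j, (M i j).IsHomogeneous 1) → M.det = f₁ * f₂ →
      ((∃ (A B : Matrix (Fin (d₁ + d₂)) (Fin (d₁ + d₂)) k)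
          (M₁ : Matrix (Fin d₁) (Fin d₁) (MvPolynomial (Fin (n + 1)) k))
          (M₂ : Matrix (Fin d₂) (Fin d₂) (MvPolynomial (Fin (n + 1)) k)) (c₁ c₂ : k),
          IsUnit A ∧ IsUnit B ∧ c₁ ≠ 0 ∧ c₂ ≠ 0 ∧
            A.map MvPolynomial.C * M * B.map MvPolynomial.C =
              (Matrix.fromBlocks M₁ 0 0 M₂).reindex finSumFinEquiv finSumFinEquiv ∧
            M₁.det = MvPolynomial.C c₁ * f₁ ∧ M₂.det = MvPolynomial.C c₂ * f₂) ↔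
        ∀ a : Fin (n + 1) → k, a ≠ 0 → MvPolynomial.eval a f₁ = 0 → MvPolynomial.eval a f₂ = 0 →
          letI : (RingHom.ker (MvPolynomial.eval a)).IsPrime := RingHom.ker_isPrime (MvPolynomial.eval a)
          ∃ (r e₁ e₂ : ℕ) (h : r + e₁ + e₂ = d₁ + d₂)
            (A B : Matrix (Fin (d₁ + d₂)) (Fin (d₁ + d₂))
              (Localization.AtPrime (RingHom.ker (MvPolynomial.eval a))))
            (N₁ : Matrix (Fin e₁) (Fin e₁) (Localization.AtPrime (RingHom.ker (MvPolynomial.eval a))))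
            (N₂ : Matrix (Fin e₂) (Fin e₂) (Localization.AtPrime (RingHom.ker (MvPolynomial.eval a))))
            (u₁ u₂ : (Localization.AtPrime (RingHom.ker (MvPolynomial.eval a)))ˣ),
            IsUnit A ∧ IsUnit B ∧
              A * M.map (algebraMap (MvPolynomial (Fin (n + 1)) k)
                    (Localization.AtPrime (RingHom.ker (MvPolynomial.eval a)))) * B =
                (Matrix.fromBlocks (1 : Matrix (Fin r) (Fin r) _) 0 0 (Matrix.fromBlocks N₁ 0 0 N₂)).reindex
                  (blockIndexEquiv h) (blockIndexEquiv h) ∧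
              N₁.det = (u₁ : Localization.AtPrime (RingHom.ker (MvPolynomial.eval a))) *
                  algebraMap (MvPolynomial (Fin (n + 1)) k) _ f₁ ∧
              N₂.det = (u₂ : Localization.AtPrime (RingHom.ker (MvPolynomial.eval a))) *
                  algebraMap (MvPolynomial (Fin (n + 1)) k) _ f₂)

end Literature.AlgebraicGeometry.DeterminantalHypersurfaces

end
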